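/- Copyright: the b2b-balaban cell (near-miss cell 7), T⁴-continuum fan-out; row NE7b OWNER lineage `t4-ne7b-p1`
(gen 56) — (ρ1) in R-OWNER-49-1's order of attack after R-OWNER-55-1's (ρ0): «THE INDEX READING IS A COUNT».
Released under the licence of the surrounding project. -/
import Summits.QuantumFields.BalabanUV.T4Continuum.Support.HistoryBankingFibreDecorSlice

/-!
# (ρ1) «THE INDEX READING IS A COUNT»: the displayed decoration of a key fibre is, once its data is quantified away,
ONE cardinality sentence per key, outer summand and curly summand — and the fibre-mass junction needs only the count

Summits-side support leaf of the T⁴-continuum cell (rung (B)+1 on a FINITE torus only; NOT infinite volume, NOT the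
mass gap, NOT the Clay statement; NOT a proof of the spine estimate NE7b — the cell's OWN estimate, NOT PRINTED, NOT
PROVED).  [folklore] finite combinatorics over M1's index (`B16HistoryIndexedRepr.HIndex`: `HZs`∕`HYs`∕`LIdx`;
`B16HistoryIndexedFamily`: `HIndex.Idx`, `termSet`), the fibre of a key map (`T4LiveClassFibration.fibre`), leaf-02's
slice (`HistoryBankingFibreDecorSlice`: `sliceOf`, `CslOf`, `SIdx`, `eq_of_mem_termSet`) and decorated genealogies
(`HistoryBankingFibreDecorKeys`: `decG`, `card_decG_eq_ncount`, `prod_card_decG_le_MULTOf`), the owner's S25 node count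
(`HistoryBankingFibreResum`: `ncount`; `HistoryPriceKeys.MULTOf`); no `structure` hypothesis shape, no `[cite:]` tag, no
`def … : Prop` fact of Bałaban's, zero `sorry`.  B16 = [Balaban1989LargeFieldII] (1.71)∕(1.72) pp. 378–379 (the history
letters) and p. 383 l. 25–26 «the summations over the admissible sequences can be replaced by the factors
exp O(1)(MR_j)^{−d}|Z_j|» are quoted as LOCATORS of hypothesis shapes only; nothing printed is asserted.

WHY.  After R-OWNER-49-1 ∕ IR-49-1 the located display (ρ) `FibreMass` of the (α) record of record is read off the key
through (ρ0) (R-OWNER-55-1: typed at the input level, `HistoryGenealogyLiveIndex`), (ρ1) = the three items {`kdDec`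
(data: the decoration a term writes on a member), `kdMem`, `kdInj`} of `HistReadDataLWK` (equivalently `IndexDecor`'s
`hmem`∕`hinj` with leaf-02's `sliceOf`), (ρ2) (T∕PARAMETRIC) and (ρ3) (KERNEL modulo FIBRE-1, served).  (ρ1) was classed
R — «an identification of `HistRead`'s index class: the history pair IS (slice; per live member its admissible
sub-sequence), written as an injective decoration».  This file shows WHAT (ρ1) ASSERTS ONCE ITS DATA IS QUANTIFIED
AWAY: at every cutoff `K`, key `k`, outer summand `a` and curly summand `c`, the number of history pairs `(h, ℓ)` with
`⟨K, a, (h, ℓ, c)⟩` in the fibre of `k` is at most the product over the members `w ∈ k` of the sizes of their decoration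
sets — NOTHING ELSE: an injective per-member decoration EXISTS iff this count holds (`exists_decoration_iff_count`,
pigeonhole on finite sets).  With the decoration sets of record `decG (kdC K w) w.2.1` the bound is
`∏_{w ∈ k} ncount (#kdC K w ·) w.2.1` (`count_of_kd`, by `card_decG_eq_ncount`) and under (ρ3)'s letters
`MULTOf (sharpT φB φR) k`.  So (ρ1)'s R-content is EXACTLY print's counting sentence p. 383 l. 25–26 read PER MEMBER of
the key fibre — modulo the (1.71)-form identification «history pairs of a key fibre = admissible sub-sequences on its
members», which is what stays R — and the fibre-mass junction can be fed the COUNT directly, with no decoration data at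
all (`fibreMass_of_count`, `fibreMass_of_count_MULTOf`).

WHAT.  §1 `mk_mem_termSet_iff`, `mk_eq_mk_iff`, `mkIdx`; **`pairsOf kmem K k a c`** (the history pairs of the fibre of
`k` at `(a, c)`), `mem_pairsOf`, `pairsOf_subset`, `card_pairsOf_le_card_mul` (the reading-free bound `#HZs a · #HYs a`),
`card_filter_sliceOf_eq_card_pairsOf` (the fibre's terms of slice `⟨K, a, c⟩` are counted by `pairsOf`).  §2 (⇒)
**`card_pairsOf_le_of_decoration`**: `hmem` + the history-pair `hinj` ⇒ `#pairsOf ≤ ∏_{w ∈ k} #Dec w` (injection into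
`k.pi Dec`, `Finset.card_pi`); `count_of_kd` (the record's (ρ1) triple ⇒ the count at `decG`, in `ncount` form).  §3
(⇐) **`decorationOfCount`** (`kdDec`-shaped data built from a count by a choice of embeddings,
`Function.Embedding.nonempty_of_card_le`) with `decorationOfCount_mem` (`kdMem`-shaped) and `decorationOfCount_inj`
(`kdInj`-shaped); **`exists_decoration_iff_count`**.  §4 `sum_fibre_slice_eq`; **`fibreMass_of_count`**: the conclusion of
`fibreMass_of_decoration_idx` — `∑_{τ ∈ fibre k} dmass τ ≤ W · B` — from (ρ2)'s slice envelope and ANY bound `B ≥ 0` on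
the counts, decoration-free; **`fibreMass_of_count_MULTOf`** (at the letters of record: leaf-02's
`fibreMass_of_genDecoration_idx` with {`dec`, `hmem`, `hinj`} REPLACED by the count).  §5 a decided toy (one-point
skeleton: the count `1 ≤ 1` holds, hence a decoration exists — the shape is inhabited by counting alone).

HONEST SCOPE.  Bookkeeping over OUR carriers: an equivalence between two hypothesis SHAPES and a junction.  (ρ1) is NOT
discharged — the count is as much a reading of (1.71)∕(1.72)'s index onto the key fibre as the decoration was; what is
gained is its FORM: one inequality per `(K, k, a, c)` with print's p. 383 sentence as locus, no data, no map.  BY-NAME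
EFFECT ON THE WALL: row `resum`∕(ρ) — (ρ1) RE-WORDED ONLY («R, identification by an injective decoration» ↦ «R, THE
HISTORY COUNT per key fibre and summand pair, VERBATIM-IN-PRINT as the form of p. 383 l. 25–26 per member; the decoration
data `kdDec` is eliminable»); R-rows by count UNCHANGED.  NE7b NOT PRINTED ∕ NOT PROVED; spine 0∕9.  HONEST DEPENDENCY
(cell): continuum YM on T⁴ ⇐ BetaPertH ∧ nine spine estimates (0/9 proved); BetaPertH ⇐ (D1) ∧ (D4) ∧ CAP+tail;
G-an2-4 gates asym, D1 and NE2/3/4.  This file changes none of it.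
-/

open Finset
open Literature.MathematicalPhysics.QuantumFieldTheory.Balaban1983to89
open T4PersistenceDictionary T4LiveClassFibration
open Summit.QuantumFields.BalabanUV.T4Continuum.HistoryPriceNodeSum
open Summit.QuantumFields.BalabanUV.T4Continuum.HistoryPriceKeys
open Summit.QuantumFields.BalabanUV.T4Continuum.HistoryBankingFibreResum
open Summit.QuantumFields.BalabanUV.T4Continuum.HistoryBankingFibreDecorKeys
open Summit.QuantumFields.BalabanUV.T4Continuum.HistoryBankingFibreDecorSlice
open Summit.QuantumFields.BalabanUV.T4Continuum.B16HistoryIndexedRepr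

namespace Summit.QuantumFields.BalabanUV.T4Continuum.HistoryBankingFibreCount

noncomputable section

variable {DomK : ℕ → Type*} {I : (K : ℕ) → HIndex (DomK K)} {ω : Type*}

/-! ## §1 The history pairs of a key fibre at a fixed outer and curly summand -/

/-- an explicit triple is a term of `termSet I K` iff its history choice lies in the level's index set of its outer
summand [folklore] -/
theorem mk_mem_termSet_iff {K : ℕ} {a : (I K).Adm} {ι : (I K).HZ × (I K).HL × (I K).HC} :
    (⟨K, a, ι⟩ : HIndex.Idx I) ∈ HIndex.termSet I K ↔ ι ∈ (I K).LIdx a := by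
  constructor
  · intro h
    obtain ⟨a', h', l', c', hmem, he⟩ := eq_of_mem_termSet h
    obtain ⟨rfl, h3⟩ := Sigma.mk.inj_iff.1 (eq_of_heq (Sigma.mk.inj_iff.1 he).2)
    rw [eq_of_heq h3]
    exact hmem
  · intro h
    exact Finset.mem_map.2 ⟨⟨a, ι⟩, Finset.mem_sigma.2 ⟨Finset.mem_univ _, h⟩, rfl⟩

/-- **THE TERM OF A HISTORY PAIR** at cutoff `K`, outer summand `a`, curly summand `c`: `(h, ℓ) ↦ ⟨K, a, (h, ℓ, c)⟩`
(by `rfl` the triple `⟨K, a, (p.1, p.2, c)⟩` of the record's `kdInj`). [folklore] -/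
def mkIdx (K : ℕ) (a : (I K).Adm) (c : (I K).HC) (p : (I K).HZ × (I K).HL) : HIndex.Idx I := ⟨K, a, (p.1, p.2, c)⟩

/-- two triples at one cutoff with the same outer and curly summand are equal iff their history pairs are [folklore] -/
theorem mk_eq_mk_iff {K : ℕ} {a : (I K).Adm} {c : (I K).HC} {p p' : (I K).HZ × (I K).HL} :
    mkIdx K a c p = mkIdx K a c p' ↔ p = p' := by
  constructor
  · intro h
    have h3 := eq_of_heq (Sigma.mk.inj_iff.1 (eq_of_heq (Sigma.mk.inj_iff.1 h).2)).2
    simp only [Prod.mk.injEq, and_true] at h3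
    exact Prod.ext h3.1 h3.2
  · rintro rfl
    rfl

variable [DecidableEq ω]

open Classical in
/-- **THE HISTORY PAIRS OF A KEY FIBRE AT `(a, c)`**: the pairs `(h, ℓ)` — history of `Z_K`, sub-histories inside the
`Y_i`, (1.71)∕(1.72) pp. 378–379 (locator) — for which the term `⟨K, a, (h, ℓ, c)⟩` lies in the fibre of the key `k`
at cutoff `K`. [folklore] -/
def pairsOf (kmem : ℕ → HIndex.Idx I → Finset ω) (K : ℕ) (k : Finset ω) (a : (I K).Adm) (c : (I K).HC) :
    Finset ((I K).HZ × (I K).HL) :=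
  ((I K).HZs a ×ˢ (I K).HYs a).filter fun p => mkIdx K a c p ∈ fibre kmem (HIndex.termSet I) K k

open Classical in
/-- membership in the history pairs: exactly fibre membership of the term (its level-set membership is implied)
[folklore] -/
theorem mem_pairsOf {kmem : ℕ → HIndex.Idx I → Finset ω} {K : ℕ} {k : Finset ω} {a : (I K).Adm} {c : (I K).HC}
    {p : (I K).HZ × (I K).HL} :
    p ∈ pairsOf kmem K k a c ↔ (⟨K, a, (p.1, p.2, c)⟩ : HIndex.Idx I) ∈ fibre kmem (HIndex.termSet I) K k := by
  unfold pairsOf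
  rw [Finset.mem_filter]
  refine ⟨fun h => h.2, fun h => ⟨?_, h⟩⟩
  have ht : ((p.1, p.2, c) : (I K).HZ × (I K).HL × (I K).HC) ∈ (I K).LIdx a :=
    mk_mem_termSet_iff.1 (mem_fibre.1 h).1
  unfold HIndex.LIdx at ht
  rw [Finset.mem_product, Finset.mem_product] at ht
  exact Finset.mem_product.2 ⟨ht.1, ht.2.1⟩

open Classical in
/-- the history pairs lie in the level's pair set `HZs a ×ˢ HYs a` [folklore] -/
theorem pairsOf_subset (kmem : ℕ → HIndex.Idx I → Finset ω) (K : ℕ) (k : Finset ω) (a : (I K).Adm) (c : (I K).HC) :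
    pairsOf kmem K k a c ⊆ (I K).HZs a ×ˢ (I K).HYs a := by
  unfold pairsOf
  exact Finset.filter_subset _ _

/-- the reading-free count: at most `#HZs a · #HYs a` history pairs (finite by M1's skeleton alone) [folklore] -/
theorem card_pairsOf_le_card_mul (kmem : ℕ → HIndex.Idx I → Finset ω) (K : ℕ) (k : Finset ω) (a : (I K).Adm)
    (c : (I K).HC) : (pairsOf kmem K k a c).card ≤ ((I K).HZs a).card * ((I K).HYs a).card := by
  rw [← Finset.card_product]
  exact Finset.card_le_card (pairsOf_subset kmem K k a c)

open Classical in
/-- **THE FIBRE's TERMS OF SLICE `⟨K, a, c⟩` ARE COUNTED BY THE HISTORY PAIRS**: the terms of the fibre of `k` whose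
slice is `⟨K, a, c⟩` are in bijection with `pairsOf kmem K k a c` by `mkIdx K a c`. [folklore] -/
theorem card_filter_sliceOf_eq_card_pairsOf (kmem : ℕ → HIndex.Idx I → Finset ω) (K : ℕ) (k : Finset ω)
    (a : (I K).Adm) (c : (I K).HC) :
    ((fibre kmem (HIndex.termSet I) K k).filter fun τ => sliceOf I τ = (⟨K, a, c⟩ : SIdx I)).card =
      (pairsOf kmem K k a c).card := by
  have himg : ((fibre kmem (HIndex.termSet I) K k).filter fun τ => sliceOf I τ = (⟨K, a, c⟩ : SIdx I)) =
      (pairsOf kmem K k a c).image (mkIdx K a c) := by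
    ext τ
    constructor
    · intro hτ
      obtain ⟨hf, hs⟩ := Finset.mem_filter.1 hτ
      obtain ⟨a', h, l, c', -, rfl⟩ := eq_of_mem_termSet (mem_fibre.1 hf).1
      have hs' : sliceOf I ⟨K, a', (h, l, c')⟩ = sliceOf I ⟨K, a, (h, l, c)⟩ := by rw [hs, sliceOf_mk]
      obtain ⟨rfl, rfl⟩ := sliceOf_eq_iff.1 hs'
      exact Finset.mem_image.2 ⟨(h, l), mem_pairsOf.2 hf, rfl⟩
    · intro hτ
      obtain ⟨p, hp, rfl⟩ := Finset.mem_image.1 hτ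
      exact Finset.mem_filter.2 ⟨mem_pairsOf.1 hp, sliceOf_mk I K a p.1 p.2 c⟩
  rw [himg, Finset.card_image_of_injOn fun p _ p' _ hpp => mk_eq_mk_iff.1 hpp]

/-! ## §2 (⇒) An injective per-member decoration of the fibre bounds the history count -/

/-- **(ρ1)'s DISPLAYS IMPLY THE COUNT**: if every fibre term writes on each member `w ∈ k` a decoration from the finite
set `Dec w` (`hmem`) and, at fixed outer and curly summand, the history pair is determined by the decorations (`hinj`,
leaf-02's reduced form), then `#pairsOf ≤ ∏_{w ∈ k} #Dec w` — the decorations inject the history pairs into the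
product set `k.pi Dec`. [folklore] -/
theorem card_pairsOf_le_of_decoration {δ : Type*} (kmem : ℕ → HIndex.Idx I → Finset ω) (K : ℕ) (k : Finset ω)
    (Dec : ω → Finset δ) (dec : HIndex.Idx I → ω → δ)
    (hmem : ∀ τ ∈ fibre kmem (HIndex.termSet I) K k, ∀ w ∈ k, dec τ w ∈ Dec w)
    (hinj : ∀ (a : (I K).Adm) (c : (I K).HC) (p p' : (I K).HZ × (I K).HL),
      (⟨K, a, (p.1, p.2, c)⟩ : HIndex.Idx I) ∈ fibre kmem (HIndex.termSet I) K k →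
      (⟨K, a, (p'.1, p'.2, c)⟩ : HIndex.Idx I) ∈ fibre kmem (HIndex.termSet I) K k →
      (∀ w ∈ k, dec ⟨K, a, (p.1, p.2, c)⟩ w = dec ⟨K, a, (p'.1, p'.2, c)⟩ w) → p = p')
    (a : (I K).Adm) (c : (I K).HC) :
    (pairsOf kmem K k a c).card ≤ ∏ w ∈ k, (Dec w).card := by
  rw [← Finset.card_pi]
  refine Finset.card_le_card_of_injOn (fun p => fun w _ => dec (mkIdx K a c p) w) ?_ ?_
  · intro p hp
    exact Finset.mem_coe.2 (Finset.mem_pi.2 fun w hw => hmem _ (mem_pairsOf.1 (Finset.mem_coe.1 hp)) w hw)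
  · intro p hp p' hp' hf
    exact hinj a c p p' (mem_pairsOf.1 (Finset.mem_coe.1 hp)) (mem_pairsOf.1 (Finset.mem_coe.1 hp'))
      fun w hw => congrFun (congrFun hf w) hw

variable {γ δ' : Type*} [DecidableEq γ] [DecidableEq δ']

/-- **THE RECORD's (ρ1) TRIPLE GIVES THE COUNT AT `decG`** (`kdDec`∕`kdMem`∕`kdInj`-shaped hypotheses, one cutoff and
key): `#pairsOf ≤ ∏_{w ∈ k} ncount (#C w ·) w.2.1` — print's p. 383 l. 25–26 count, PER MEMBER of the key, as the
consequence of the displayed decoration (`card_decG_eq_ncount`). [folklore] -/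
theorem count_of_kd {β : Type*} [DecidableEq β]
    (kmem : ℕ → HIndex.Idx I → Finset (γ × Gen PEv × δ')) (K : ℕ) (k : Finset (γ × Gen PEv × δ'))
    (C : γ × Gen PEv × δ' → PEv → Finset β) (dec : HIndex.Idx I → γ × Gen PEv × δ' → Gen (PEv × β))
    (hmem : ∀ τ ∈ fibre kmem (HIndex.termSet I) K k, ∀ w ∈ k, dec τ w ∈ decG (C w) w.2.1)
    (hinj : ∀ (a : (I K).Adm) (c : (I K).HC) (p p' : (I K).HZ × (I K).HL),
      (⟨K, a, (p.1, p.2, c)⟩ : HIndex.Idx I) ∈ fibre kmem (HIndex.termSet I) K k →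
      (⟨K, a, (p'.1, p'.2, c)⟩ : HIndex.Idx I) ∈ fibre kmem (HIndex.termSet I) K k →
      (∀ w ∈ k, dec ⟨K, a, (p.1, p.2, c)⟩ w = dec ⟨K, a, (p'.1, p'.2, c)⟩ w) → p = p')
    (a : (I K).Adm) (c : (I K).HC) :
    (pairsOf kmem K k a c).card ≤ ∏ w ∈ k, ncount (fun e => (C w e).card) w.2.1 := by
  rw [← Finset.prod_congr rfl fun w _ => card_decG_eq_ncount (C w) w.2.1]
  exact card_pairsOf_le_of_decoration kmem K k (fun w => decG (C w) w.2.1) dec hmem hinj a c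

/-! ## §3 (⇐) A count yields an injective per-member decoration -/

section Build

variable {δ : Type*} [Inhabited δ] (kmem : ℕ → HIndex.Idx I → Finset ω) (Dec : ℕ → ω → Finset δ)
  (S : ℕ → Finset (Finset ω))
  (hcount : ∀ K, ∀ k ∈ S K, ∀ (a : (I K).Adm) (c : (I K).HC),
    (pairsOf kmem K k a c).card ≤ ∏ w ∈ k, (Dec K w).card)

/-- a chosen embedding of the history pairs at `(K, k, a, c)`, `k ∈ S K` displayed, into the product of the members'
decoration sets — it exists by the count (`Function.Embedding.nonempty_of_card_le`, `Finset.card_pi`) [folklore] -/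
def embOf (K : ℕ) (k : Finset ω) (hk : k ∈ S K) (a : (I K).Adm) (c : (I K).HC) :
    ↥(pairsOf kmem K k a c) ↪ ↥(k.pi (Dec K)) :=
  Classical.choice (Function.Embedding.nonempty_of_card_le (by
    rw [Fintype.card_coe, Fintype.card_coe, Finset.card_pi]; exact hcount K k hk a c))

open Classical in
/-- the decoration at explicit components `(K, a, c, h, ℓ)` and member `w`: the chosen embedding's `w`-component when
the term's key is displayed, the pair lies in the fibre and `w` is a member; `default` elsewhere [folklore] -/
def decAt (K : ℕ) (a : (I K).Adm) (c : (I K).HC) (h : (I K).HZ) (l : (I K).HL) (w : ω) : δ :=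
  if hk : kmem K ⟨K, a, (h, l, c)⟩ ∈ S K then
    if hp : (h, l) ∈ pairsOf kmem K (kmem K ⟨K, a, (h, l, c)⟩) a c then
      if hw : w ∈ kmem K ⟨K, a, (h, l, c)⟩ then (embOf kmem Dec S hcount K _ hk a c ⟨(h, l), hp⟩).1 w hw
      else default
    else default
  else default

/-- **THE DECORATION BUILT FROM A COUNT** (`kdDec`-shaped: cutoff argument, term, member): on `⟨K, a, (h, ℓ, c)⟩` it is
`decAt K a c h ℓ` (the first argument is not read — a fibre term carries its cutoff). [folklore] -/
def decorationOfCount : ℕ → HIndex.Idx I → ω → δ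
  | _, ⟨K, a, (h, l, c)⟩, w => decAt kmem Dec S hcount K a c h l w

/-- on a fibre term the built decoration is the chosen embedding's component [folklore] -/
theorem decorationOfCount_eq {K K' : ℕ} {k : Finset ω} (hk : k ∈ S K) {a : (I K).Adm} {c : (I K).HC}
    {h : (I K).HZ} {l : (I K).HL} (hp : (⟨K, a, (h, l, c)⟩ : HIndex.Idx I) ∈ fibre kmem (HIndex.termSet I) K k)
    {w : ω} (hw : w ∈ k) :
    decorationOfCount kmem Dec S hcount K' ⟨K, a, (h, l, c)⟩ w =
      (embOf kmem Dec S hcount K k hk a c ⟨(h, l), mem_pairsOf.2 hp⟩).1 w hw := by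
  have hkey : kmem K ⟨K, a, (h, l, c)⟩ = k := (mem_fibre.1 hp).2
  subst hkey
  show decAt kmem Dec S hcount K a c h l w = _
  unfold decAt
  rw [dif_pos hk, dif_pos (mem_pairsOf.2 hp), dif_pos hw]

/-- **THE BUILT DECORATION LIES IN THE DECORATION SETS** (`kdMem`∕`hmem`-shaped). [folklore] -/
theorem decorationOfCount_mem (K K' : ℕ) {k : Finset ω} (hk : k ∈ S K) :
    ∀ τ ∈ fibre kmem (HIndex.termSet I) K k, ∀ w ∈ k, decorationOfCount kmem Dec S hcount K' τ w ∈ Dec K w := by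
  intro τ hτ w hw
  obtain ⟨a, h, l, c, -, rfl⟩ := eq_of_mem_termSet (mem_fibre.1 hτ).1
  rw [decorationOfCount_eq kmem Dec S hcount hk hτ hw]
  exact Finset.mem_pi.1 (embOf kmem Dec S hcount K k hk a c ⟨(h, l), mem_pairsOf.2 hτ⟩).2 w hw

/-- **THE BUILT DECORATION DETERMINES THE HISTORY PAIR** (`kdInj`∕reduced-`hinj`-shaped). [folklore] -/
theorem decorationOfCount_inj (K K' : ℕ) {k : Finset ω} (hk : k ∈ S K) :
    ∀ (a : (I K).Adm) (c : (I K).HC) (p p' : (I K).HZ × (I K).HL),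
      (⟨K, a, (p.1, p.2, c)⟩ : HIndex.Idx I) ∈ fibre kmem (HIndex.termSet I) K k →
      (⟨K, a, (p'.1, p'.2, c)⟩ : HIndex.Idx I) ∈ fibre kmem (HIndex.termSet I) K k →
      (∀ w ∈ k, decorationOfCount kmem Dec S hcount K' ⟨K, a, (p.1, p.2, c)⟩ w =
        decorationOfCount kmem Dec S hcount K' ⟨K, a, (p'.1, p'.2, c)⟩ w) → p = p' := by
  intro a c p p' hp hp' heq
  have hE : embOf kmem Dec S hcount K k hk a c ⟨(p.1, p.2), mem_pairsOf.2 hp⟩ =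
      embOf kmem Dec S hcount K k hk a c ⟨(p'.1, p'.2), mem_pairsOf.2 hp'⟩ := by
    apply Subtype.ext
    funext w hw
    have h1 := heq w hw
    rwa [decorationOfCount_eq kmem Dec S hcount hk hp hw, decorationOfCount_eq kmem Dec S hcount hk hp' hw] at h1
  have hv := congrArg Subtype.val ((embOf kmem Dec S hcount K k hk a c).injective hE)
  exact Prod.ext (congrArg Prod.fst hv) (congrArg Prod.snd hv)

end Build

/-- **(ρ1) ⟺ THE COUNT** (one cutoff, one key; decoration sets `Dec`; `δ` inhabited): an injective per-member
decoration of the key fibre — the (ρ1) display pair `hmem` + history-pair `hinj` for SOME data `dec` — EXISTS iff at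
every outer and curly summand the history pairs number at most the product of the decoration-set sizes.  The
R-content of (ρ1) is this count; the data `dec` is eliminable. [folklore] -/
theorem exists_decoration_iff_count {δ : Type*} [Inhabited δ] (kmem : ℕ → HIndex.Idx I → Finset ω) (K : ℕ)
    (k : Finset ω) (Dec : ω → Finset δ) :
    (∃ dec : HIndex.Idx I → ω → δ,
      (∀ τ ∈ fibre kmem (HIndex.termSet I) K k, ∀ w ∈ k, dec τ w ∈ Dec w) ∧
      (∀ (a : (I K).Adm) (c : (I K).HC) (p p' : (I K).HZ × (I K).HL),
        (⟨K, a, (p.1, p.2, c)⟩ : HIndex.Idx I) ∈ fibre kmem (HIndex.termSet I) K k →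
        (⟨K, a, (p'.1, p'.2, c)⟩ : HIndex.Idx I) ∈ fibre kmem (HIndex.termSet I) K k →
        (∀ w ∈ k, dec ⟨K, a, (p.1, p.2, c)⟩ w = dec ⟨K, a, (p'.1, p'.2, c)⟩ w) → p = p')) ↔
    ∀ (a : (I K).Adm) (c : (I K).HC), (pairsOf kmem K k a c).card ≤ ∏ w ∈ k, (Dec w).card := by
  refine ⟨fun ⟨dec, hmem, hinj⟩ a c => card_pairsOf_le_of_decoration kmem K k Dec dec hmem hinj a c, fun hc => ?_⟩
  -- display the single key `k` at cutoff `K` only; the count is then `hc` itself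
  let S : ℕ → Finset (Finset ω) := fun K' => if K' = K then {k} else ∅
  have hS : ∀ K', ∀ k' ∈ S K', K' = K ∧ k' = k := by
    intro K' k' hk'
    by_cases hK : K' = K
    · simp only [S, if_pos hK, Finset.mem_singleton] at hk'; exact ⟨hK, hk'⟩
    · simp only [S, if_neg hK] at hk'; exact absurd hk' (Finset.notMem_empty _)
  have hcount : ∀ K', ∀ k' ∈ S K', ∀ (a : (I K').Adm) (c : (I K').HC),
      (pairsOf kmem K' k' a c).card ≤ ∏ w ∈ k', ((fun _ => Dec) K' w).card := by
    intro K' k' hk' a c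
    obtain ⟨rfl, rfl⟩ := hS K' k' hk'
    exact hc a c
  have hk : k ∈ S K := by simp only [S, if_pos rfl, Finset.mem_singleton]
  exact ⟨decorationOfCount kmem (fun _ => Dec) S hcount K, decorationOfCount_mem kmem (fun _ => Dec) S hcount K K hk,
    decorationOfCount_inj kmem (fun _ => Dec) S hcount K K hk⟩

/-! ## §4 The fibre-mass junction from the COUNT (decoration-free) -/

open Classical in
/-- re-indexing: summing a slice function over the fibre = summing over the slices met, each weighted by the number of
fibre terms of that slice [folklore] -/
theorem sum_fibre_slice_eq (kmem : ℕ → HIndex.Idx I → Finset ω) (K : ℕ) (k : Finset ω) (v : SIdx I → ℝ) :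
    ∑ τ ∈ fibre kmem (HIndex.termSet I) K k, v (sliceOf I τ) =
      ∑ s ∈ CslOf I kmem K k,
        (((fibre kmem (HIndex.termSet I) K k).filter fun τ => sliceOf I τ = s).card : ℝ) * v s := by
  rw [← Finset.sum_fiberwise_of_maps_to' (g := sliceOf I) (fun τ hτ => sliceOf_mem_CslOf hτ) v]
  exact Finset.sum_congr rfl fun s _ => by rw [Finset.sum_const, nsmul_eq_mul]

open Classical in
/-- **(ρ) `FibreMass` FROM THE COUNT** — the conclusion of leaf-02's `fibreMass_of_decoration_idx` ∕ the shape of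
`HistReadDataL(W).hρ` at one cutoff, class and source value, WITHOUT ANY DECORATION DATA: if every fibre term's mass is
below its slice's envelope (ρ2), the envelopes over the slices met sum to at most `W`, and at every outer and curly
summand the history count is at most `B ≥ 0`, then `∑_{τ ∈ fibre k} dmass τ ≤ W · B`. [folklore] -/
theorem fibreMass_of_count (kmem : ℕ → HIndex.Idx I → Finset ω) (K : ℕ) (k : Finset ω) (dmass : HIndex.Idx I → ℝ)
    {v : SIdx I → ℝ} {W B : ℝ} (hv : ∀ s ∈ CslOf I kmem K k, 0 ≤ v s) (hW : ∑ s ∈ CslOf I kmem K k, v s ≤ W)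
    (hB : 0 ≤ B) (hcount : ∀ (a : (I K).Adm) (c : (I K).HC), ((pairsOf kmem K k a c).card : ℝ) ≤ B)
    (hfac : ∀ τ ∈ fibre kmem (HIndex.termSet I) K k, dmass τ ≤ v (sliceOf I τ)) :
    ∑ τ ∈ fibre kmem (HIndex.termSet I) K k, dmass τ ≤ W * B := by
  calc ∑ τ ∈ fibre kmem (HIndex.termSet I) K k, dmass τ
      ≤ ∑ τ ∈ fibre kmem (HIndex.termSet I) K k, v (sliceOf I τ) := Finset.sum_le_sum hfac
    _ = ∑ s ∈ CslOf I kmem K k,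
          (((fibre kmem (HIndex.termSet I) K k).filter fun τ => sliceOf I τ = s).card : ℝ) * v s :=
        sum_fibre_slice_eq kmem K k v
    _ ≤ ∑ s ∈ CslOf I kmem K k, B * v s := by
        refine Finset.sum_le_sum fun s hs => mul_le_mul_of_nonneg_right ?_ (hv s hs)
        obtain ⟨τ, hτ, rfl⟩ := mem_CslOf.1 hs
        obtain ⟨a, h, l, c, -, rfl⟩ := eq_of_mem_termSet (mem_fibre.1 hτ).1
        rw [sliceOf_mk, card_filter_sliceOf_eq_card_pairsOf]
        exact hcount a c
    _ = B * ∑ s ∈ CslOf I kmem K k, v s := (Finset.mul_sum _ _ _).symm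
    _ ≤ B * W := mul_le_mul_of_nonneg_left hW hB
    _ = W * B := mul_comm _ _

/-- **(ρ) `FibreMass` FROM THE COUNT AT THE LETTERS OF RECORD**: with the decoration sets `decG (C w) w.2.1` of a key of
(cell, genealogy, physical datum) members and (ρ3)'s per-event letters `#(C w e) ≤ exp (φ e)`, a history count below
`∏_{w ∈ k} #decG (C w) w.2.1` gives `∑_{τ ∈ fibre k} dmass τ ≤ W · MULTOf φ k` — leaf-02's
`fibreMass_of_genDecoration_idx` with its (ρ1) hypotheses {`dec`, `hmem`, `hinj`} REPLACED by the count. [folklore] -/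
theorem fibreMass_of_count_MULTOf {β : Type*} [DecidableEq β]
    (kmem : ℕ → HIndex.Idx I → Finset (γ × Gen PEv × δ')) (K : ℕ) (k : Finset (γ × Gen PEv × δ'))
    (dmass : HIndex.Idx I → ℝ) (φ : PEv → ℝ) {W : ℝ} (C : γ × Gen PEv × δ' → PEv → Finset β)
    {v : SIdx I → ℝ} (hv : ∀ s ∈ CslOf I kmem K k, 0 ≤ v s) (hW : ∑ s ∈ CslOf I kmem K k, v s ≤ W)
    (hcount : ∀ (a : (I K).Adm) (c : (I K).HC),
      (pairsOf kmem K k a c).card ≤ ∏ w ∈ k, (decG (C w) w.2.1).card)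
    (hfac : ∀ τ ∈ fibre kmem (HIndex.termSet I) K k, dmass τ ≤ v (sliceOf I τ))
    (hC : ∀ w ∈ k, ∀ e ∈ w.2.1.events, ((C w e).card : ℝ) ≤ Real.exp (φ e)) :
    ∑ τ ∈ fibre kmem (HIndex.termSet I) K k, dmass τ ≤ W * MULTOf φ k := by
  refine fibreMass_of_count kmem K k dmass hv hW (MULTOf_pos φ k).le (fun a c => ?_) hfac
  calc ((pairsOf kmem K k a c).card : ℝ) ≤ ((∏ w ∈ k, (decG (C w) w.2.1).card : ℕ) : ℝ) := by
        exact_mod_cast hcount a c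
    _ = ∏ w ∈ k, ((decG (C w) w.2.1).card : ℝ) := by push_cast; rfl
    _ ≤ MULTOf φ k := prod_card_decG_le_MULTOf φ k C hC

/-! ## §5 A decided toy: one outer summand, one history pair, one member -/

namespace Toy

/-- the one-point skeleton at every cutoff: `Adm = HZ = HL = HC = Unit`, empty domains [folklore] -/
def I₁ : (K : ℕ) → HIndex (Fin 0) := fun _ =>
  { Adm := Unit, Zc := fun _ => ∅, Ys := fun _ => ∅, index_inj := fun a b _ _ => Subsingleton.elim a b,
    HZ := Unit, HL := Unit, HC := Unit, HZs := fun _ => {()}, HYs := fun _ => {()}, HCs := fun _ => {()},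
    allSmall := (), Zc_allSmall := rfl, Ys_allSmall := rfl, hz₀ := (), HZs_allSmall := rfl, hl₀ := (),
    HYs_allSmall := rfl }

/-- every term has the one-member key `{()}` [folklore] -/
def kmem₁ : ℕ → HIndex.Idx I₁ → Finset Unit := fun _ _ => {()}

/-- the toy's history count is at most one (`#HZs · #HYs = 1 = ∏ over the one member of #{()}`) [folklore] -/
theorem card_pairsOf_toy_le (K : ℕ) (a : (I₁ K).Adm) (c : (I₁ K).HC) :
    (pairsOf kmem₁ K {()} a c).card ≤ ∏ _w ∈ ({()} : Finset Unit), ({()} : Finset Unit).card :=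
  (card_pairsOf_le_card_mul kmem₁ K {()} a c).trans (by simp [I₁])

/-- **CONTENT**: on the toy the count holds, hence (`exists_decoration_iff_count`) an injective one-letter decoration
EXISTS — (ρ1)'s display shape is inhabited by counting alone, no map written by hand. [folklore] -/
theorem toy_content (K : ℕ) :
    ∃ dec : HIndex.Idx I₁ → Unit → Unit,
      (∀ τ ∈ fibre kmem₁ (HIndex.termSet I₁) K {()}, ∀ w ∈ ({()} : Finset Unit), dec τ w ∈ ({()} : Finset Unit)) ∧
      (∀ (a : (I₁ K).Adm) (c : (I₁ K).HC) (p p' : (I₁ K).HZ × (I₁ K).HL),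
        (⟨K, a, (p.1, p.2, c)⟩ : HIndex.Idx I₁) ∈ fibre kmem₁ (HIndex.termSet I₁) K {()} →
        (⟨K, a, (p'.1, p'.2, c)⟩ : HIndex.Idx I₁) ∈ fibre kmem₁ (HIndex.termSet I₁) K {()} →
        (∀ w ∈ ({()} : Finset Unit), dec ⟨K, a, (p.1, p.2, c)⟩ w = dec ⟨K, a, (p'.1, p'.2, c)⟩ w) → p = p') :=
  (exists_decoration_iff_count kmem₁ K {()} fun _ => {()}).2 (card_pairsOf_toy_le K)

end Toy

end

end Summit.QuantumFields.BalabanUV.T4Continuum.HistoryBankingFibreCount
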